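import Summits.CriticalPhenomena.SAWScalingLimit.Theorems.SAWDevelopingMapHexConjectureHexTightOfTraversalBound
import Literature.Probability.RandomPlanarGeometry.ShellTraversalNet
import Literature.Probability.RandomPlanarGeometry.HexSAWVirginizationCut
import Literature.Probability.RandomPlanarGeometry.ShellTraversalCutoff
import Literature.Probability.RandomPlanarGeometry.EmbSAWLawSums
import Mathlib.Analysis.SpecialFunctions.Pow.Asymptotics
import HarnessLib

/-!
# Exponent bootstrap for Aizenman–Burchard's hypothesis (H1) — crux `HexTight` (stmt-CriticalPhenomena-5423)

Crux `Summit.CriticalPhenomena.SAWScalingLimit.Theses.SAWDevelopingMap.HexTight` (eventual tightness of the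
critical hexagonal-lattice SAW laws), line `reversal-virgin-disc`, seat c1 (parallel continuation lead
`prover-line-stmt-CriticalPhenomena-5423-c1-0`). A LAW-LEVEL reduction, independent of the line's arc objects.

**Statement (`traversalBound_of_exponent_gt_one`).** For the critical SAW laws `hexSAWLaw Ω δ (a δ) (b δ)` of ANY
domain `Ω` and ANY endpoint family: if for some `K ≥ 0`, `λ > 1` and a threshold `k(x, ρ, R)` free per shell,
`P_δ(D(x; ρ, R) is traversed by k(x,ρ,R) separate segments of the SAW polyline) ≤ K (ρ/R)^λ` for all meshes
`δ ≤ δ₀` and shells `δ ≤ ρ < R ≤ 1`, then the same holds with EVERY exponent `λ' > 0` (constant `4^{λ'}`, a new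
threshold per shell, the same `δ₀`). In particular Aizenman–Burchard's (H1) for the critical hexagonal SAW — the
hypothesis `2 < λ` of the landed rung `MarginalWedge.stub_hexTight_of_traversalBound`
(`Theorems/SAWDevelopingMapHexConjectureHexTightOfTraversalBound.lean`) — follows from its `λ > 1` form
(`hexTight_of_traversalBound_one`), and for the line `reversal-virgin-disc` the boundary regime needs only an
exponent `> 1` (`traversalBound_of_interior_one_of_boundary_one`).

**Proof.** Fix a shell `D(x; ρ, R)`; thick shells (`R ≤ 4ρ`) are absorbed in the constant `4^{λ'}`
(`embLaw_apply_le_one`). For a thin shell let `m = (ρ+R)/2`, `h = (R-ρ)/2` (`m ≤ 2h`), and put `M` net points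
`c_j = x + m e^{i(-π + 2πj/M)}` on the middle circle. By the net localization WITH THRESHOLDS
(`Curve.exists_net_hasTraversals_of_hasTraversals`: every traversal passes the middle circle within `w = 2πm/M` of a
net point; pigeonhole with weights), a polyline with `Σ_j k(c_j, w, h - w)` separate traversals of `D(x; ρ, R)` has
`k(c_j, w, h - w)` separate traversals of the small shell `D(c_j; w, h - w)` for some `j`; at a FINE mesh `δ ≤ w`
the hypothesis and the union bound give `P ≤ M · K (w/(h-w))^λ ≤ K (8π)^λ M^{1-λ} → 0` (`M → ∞`, `λ > 1`,
`tendsto_rpow_neg_atTop`), so `M = M(ρ/R)` makes it `≤ (ρ/R)^{λ'}`; at a COARSE mesh `w < δ ≤ ρ` the event is EMPTY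
once the threshold also exceeds twice the number of faces that can lie in `B̄(x, ρ + δ)` (a SAW visits each face
once: `card_le_of_vertexTraversals_nodup`, `vertexTraversals_of_hasTraversals_toCurve`; the faces form a finite
set fixed by the shell because `1/δ < 1/w`), `exists_coarse_cutoff`. The threshold of the shell is the maximum of
the two. No lattice estimate and no named fact is used; everything is plane geometry and bookkeeping.

References: M. Aizenman, A. Burchard, Duke Math. J. 99 (1999) 419–453, §1.b (1.3), Lemma 3.1 (covering / net
arguments) [AizenmanBurchardDuke1999]; H. Duminil-Copin, S. Smirnov, Ann. of Math. 175 (2012) §4 (the laws)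
[DuminilCopinSmirnov2012].
-/

noncomputable section

open scoped BigOperators Classical
open MeasureTheory Filter Topology Set Metric
open Literature.Probability.LatticeModels Literature.Probability.RandomPlanarGeometry
  Literature.Probability.RandomPlanarGeometry.SAW
open Summit.CriticalPhenomena.SAWScalingLimit.Theorems.ObservableToSLE.Negative (finite_embMeshVertices_hex)
open Summit.CriticalPhenomena.SAWScalingLimit.Theorems.DefectDecoherence.TipMartingale
  (dist_hexCenter_le_one_of_adj)
open Summit.CriticalPhenomena.SAWScalingLimit.Theorems.HexConjecture.MarginalWedge (hexPolyline)

namespace Summit.CriticalPhenomena.SAWScalingLimit.Theorems.HexTight.ExponentBootstrap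

/-! ### The coarse-mesh cutoff: at meshes `δ ≥ w` a shell of inner radius `ρ ≥ δ` is traversed boundedly often -/

/-- **Coarse-mesh cutoff.** For a shell `D(x; ρ, R)` and a positive lower bound `w` for the mesh there is a
threshold `kc` such that at every mesh `δ ∈ [w, ρ]` with `ρ + 2δ < R`, NO self-avoiding polyline of `Ω_δ ⊆ δℍ`
(any `Ω`, any endpoints) traverses `D(x; ρ, R)` by `kc` separate segments: `kc` separate traversals give `kc`
weak vertex traversals of `D(x/δ; ρ/δ + 1, R/δ - 1)` on the face centres, every other one separated, whose near
faces are distinct (a path repeats no vertex) members of the finite set of faces with centre of norm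
`< (‖x‖ + ρ)/w + 2` — so `kc := 2(#faces + 1)` is impossible. -/
theorem exists_coarse_cutoff (x : ℂ) (ρ R w : ℝ) (hw : 0 < w) :
    ∃ kc : ℕ, ∀ (Ω : Set ℂ) (δ : ℝ) (a b : HexVertex), w ≤ δ → δ ≤ ρ → ρ + 2 * δ < R →
      ∀ γ : HexDomainSAW Ω δ a b,
        ¬ (⟨γ.walk.toCurve fun v => (δ : ℂ) * hexCenter v⟩ : Curve ℂ).HasTraversals kc x ρ R := by
  -- the finite set of faces that can be near `x/δ` at a mesh `δ ≥ w`
  obtain ⟨Rb, hRb⟩ : ∃ Rb : ℝ, Rb = (‖x‖ + ρ) / w + 2 := ⟨_, rfl⟩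
  have hfinF : {v : HexVertex | ‖hexCenter v‖ < Rb}.Finite := by
    refine (finite_embMeshVertices_hex (Metric.isBounded_ball (x := (0 : ℂ)) (r := Rb))
      one_ne_zero).subset fun v hv => ?_
    have : ‖hexCenter v‖ < Rb := hv
    simpa only [mem_embMeshVertices_iff, Complex.ofReal_one, one_mul, Metric.mem_ball,
      dist_zero_right] using this
  set F := hfinF.toFinset with hFdef
  refine ⟨2 * (F.card + 1), fun Ω δ a b hwδ hδρ hρR γ hγ => ?_⟩
  have hδpos : 0 < δ := hw.trans_le hwδ
  have hρ : 0 < ρ := hδpos.trans_le hδρ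
  have hedge : ∀ u v : HexVertex, hexGraph.Adj u v → dist (hexCenter u) (hexCenter v) ≤ 1 :=
    fun u v h => dist_hexCenter_le_one_of_adj h
  have h' := vertexTraversals_of_hasTraversals_toCurve γ hδpos hedge hγ
  have hrR' : (ρ + δ) / δ < (R - δ) / δ := by
    rw [div_lt_div_iff_of_pos_right hδpos]; linarith
  have hcard := card_le_of_vertexTraversals_nodup F γ.isPath.support_nodup hrR'
    (fun v _ hvr => ?_) h'
  · omega
  rw [hFdef, hfinF.mem_toFinset]
  show ‖hexCenter v‖ < Rb
  have hv1 : ‖hexCenter v‖ ≤ dist (hexCenter v) (x / δ) + ‖x / (δ : ℂ)‖ := by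
    simpa only [dist_zero_right] using dist_triangle (hexCenter v) (x / δ) 0
  have hxδ : ‖x / (δ : ℂ)‖ = ‖x‖ / δ := by
    rw [norm_div, Complex.norm_real, Real.norm_of_nonneg hδpos.le]
  have h1 : (‖x‖ + ρ) / δ ≤ (‖x‖ + ρ) / w :=
    div_le_div_of_nonneg_left (by positivity) hw hwδ
  have h2 : (ρ + δ) / δ + ‖x‖ / δ = (‖x‖ + ρ) / δ + 1 := by
    field_simp; ring
  calc ‖hexCenter v‖ ≤ (ρ + δ) / δ + ‖x‖ / δ := by rw [← hxδ]; linarith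
    _ = (‖x‖ + ρ) / δ + 1 := h2
    _ < Rb := by rw [hRb]; linarith

/-! ### The bootstrap -/

/-- `M ↦ M · (K (C₀/M)^λ) → 0` as `M → ∞` when `λ > 1` (`= K C₀^λ M^{1-λ}`). -/
theorem tendsto_unionBound {K C₀ lam : ℝ} (hC₀ : 0 ≤ C₀) (hlam : 1 < lam) :
    Tendsto (fun M : ℕ => (M : ℝ) * (K * (C₀ / M) ^ lam)) atTop (𝓝 0) := by
  have h1 : Tendsto (fun M : ℕ => K * C₀ ^ lam * ((M : ℝ) ^ (-(lam - 1)))) atTop (𝓝 0) := by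
    have h := (tendsto_rpow_neg_atTop (by linarith : 0 < lam - 1)).comp tendsto_natCast_atTop_atTop
    simpa using h.const_mul (K * C₀ ^ lam)
  refine h1.congr' ?_
  filter_upwards [eventually_ge_atTop 1] with M hM
  have hM0 : (0 : ℝ) < M := by exact_mod_cast hM
  rw [Real.div_rpow hC₀ hM0.le, show -(lam - 1) = 1 - lam by ring, Real.rpow_sub hM0, Real.rpow_one]
  field_simp

/-- **Exponent bootstrap for (H1).** For the critical hexagonal SAW laws of any domain and endpoint family:
Aizenman–Burchard-type traversal bounds with SOME exponent `λ > 1` (constant `K ≥ 0`, threshold free per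
shell, meshes `δ ≤ δ₀`, shells `δ ≤ ρ < R ≤ 1`) imply the bounds with EVERY exponent `λ' > 0`, with constant
`4^{λ'}`, a new threshold per shell and the same `δ₀`. (Net of the middle circle + pigeonhole with thresholds +
union bound at fine meshes; empty event at coarse meshes.) -/
theorem traversalBound_of_exponent_gt_one :
    ∀ (Ω : Set ℂ) (a b : ℝ → HexVertex) (k : ℂ → ℝ → ℝ → ℕ) (K lam δ₀ : ℝ), 0 ≤ K → 1 < lam →
      (∀ δ ∈ Set.Ioc (0 : ℝ) δ₀, ∀ (x : ℂ) (ρ R : ℝ), δ ≤ ρ → ρ < R → R ≤ 1 →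
        hexSAWLaw Ω δ (a δ) (b δ)
          {γ | (⟨γ.walk.toCurve fun v => (δ : ℂ) * hexCenter v⟩ : Curve ℂ).HasTraversals
            (k x ρ R) x ρ R} ≤ ENNReal.ofReal (K * (ρ / R) ^ lam)) →
      ∀ (lam' : ℝ), 0 < lam' →
        ∃ k' : ℂ → ℝ → ℝ → ℕ, ∀ δ ∈ Set.Ioc (0 : ℝ) δ₀, ∀ (x : ℂ) (ρ R : ℝ), δ ≤ ρ → ρ < R → R ≤ 1 →
          hexSAWLaw Ω δ (a δ) (b δ)
            {γ | (⟨γ.walk.toCurve fun v => (δ : ℂ) * hexCenter v⟩ : Curve ℂ).HasTraversals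
              (k' x ρ R) x ρ R} ≤ ENNReal.ofReal (4 ^ lam' * (ρ / R) ^ lam') := by
  intro Ω a b k K lam δ₀ hK hlam h lam' hlam'
  -- one shell at a time
  suffices key : ∀ (x : ℂ) (ρ R : ℝ), ∃ kk : ℕ, ∀ δ ∈ Set.Ioc (0 : ℝ) δ₀, δ ≤ ρ → ρ < R → R ≤ 1 →
      hexSAWLaw Ω δ (a δ) (b δ)
        {γ | (⟨γ.walk.toCurve fun v => (δ : ℂ) * hexCenter v⟩ : Curve ℂ).HasTraversals kk x ρ R} ≤
        ENNReal.ofReal (4 ^ lam' * (ρ / R) ^ lam') by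
    choose kk hkk using key
    exact ⟨kk, fun δ hδ x ρ R h₁ h₂ h₃ => hkk x ρ R δ hδ h₁ h₂ h₃⟩
  intro x ρ R
  by_cases hshell : 0 < ρ ∧ ρ < R ∧ R ≤ 1
  swap
  · exact ⟨0, fun δ hδ hδρ hρR hR1 => (hshell ⟨hδ.1.trans_le hδρ, hρR, hR1⟩).elim⟩
  obtain ⟨hρ, hρR, hR1⟩ := hshell
  have hR : 0 < R := hρ.trans hρR
  have ht0 : 0 < ρ / R := div_pos hρ hR
  have h4 : (1 : ℝ) ≤ 4 ^ lam' := Real.one_le_rpow (by norm_num) hlam'.le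
  have hε : 0 < (ρ / R) ^ lam' := Real.rpow_pos_of_pos ht0 _
  -- thick shells are absorbed in the constant
  by_cases hthick : R ≤ 4 * ρ
  · refine ⟨0, fun δ _ _ _ _ => (embLaw_apply_le_one _).trans (ENNReal.one_le_ofReal.2 ?_)⟩
    rw [← Real.mul_rpow (by norm_num) ht0.le]
    refine Real.one_le_rpow ?_ hlam'.le
    rw [mul_div_assoc', le_div_iff₀ hR]; linarith
  rw [not_le] at hthick
  -- thin shell: middle radius `m`, half width `hh`, `m ≤ 2 hh`
  obtain ⟨m, hm⟩ : ∃ m : ℝ, m = (ρ + R) / 2 := ⟨_, rfl⟩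
  obtain ⟨hh, hhh⟩ : ∃ hh : ℝ, hh = (R - ρ) / 2 := ⟨_, rfl⟩
  have hmpos : 0 < m := by rw [hm]; linarith
  have hhpos : 0 < hh := by rw [hhh]; linarith
  have hm2 : m ≤ 2 * hh := by rw [hm, hhh]; linarith
  have hh1 : hh ≤ 1 / 2 := by rw [hhh]; linarith
  -- the union-bound constant and the net size
  obtain ⟨C₀, hC₀⟩ : ∃ C₀ : ℝ, C₀ = 4 * Real.pi * m / hh := ⟨_, rfl⟩
  have hC₀pos : 0 < C₀ := by rw [hC₀]; positivity
  obtain ⟨M₀, hM₀⟩ := Filter.eventually_atTop.1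
    ((tendsto_unionBound (K := K) hC₀pos.le hlam).eventually (Iio_mem_nhds hε))
  obtain ⟨M, hMdef⟩ : ∃ M : ℕ, M = max M₀ (⌈C₀⌉₊ + 1) := ⟨_, rfl⟩
  have hMM₀ : M₀ ≤ M := hMdef ▸ le_max_left _ _
  have hMC : C₀ < M := by
    have h1 : ((⌈C₀⌉₊ + 1 : ℕ) : ℝ) ≤ M := by rw [hMdef]; exact_mod_cast le_max_right _ _
    have h2 : C₀ < ((⌈C₀⌉₊ + 1 : ℕ) : ℝ) := by
      push_cast; linarith [Nat.le_ceil C₀]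
    linarith
  have hMpos : (0 : ℝ) < M := hC₀pos.trans hMC
  have hM1 : 1 ≤ M := by
    rw [hMdef]; exact le_max_of_le_right (Nat.succ_le_succ (Nat.zero_le _))
  have hsmall : (M : ℝ) * (K * (C₀ / M) ^ lam) < (ρ / R) ^ lam' := hM₀ M hMM₀
  -- radii of the small shells: `w = 2πm/M`, outer `hh - w`; `2w < hh`
  obtain ⟨w, hw⟩ : ∃ w : ℝ, w = 2 * Real.pi * ((ρ + R) / 2) / M := ⟨_, rfl⟩
  have hw' : w = C₀ * hh / (2 * M) := by
    rw [hw, hC₀, ← hm]; field_simp; ring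
  have hwpos : 0 < w := by rw [hw']; positivity
  have h2w : 2 * w < hh := by
    rw [hw', show C₀ * hh / (2 * M) = (C₀ / M) * hh / 2 by field_simp]
    have : C₀ / M < 1 := (div_lt_one hMpos).2 hMC
    nlinarith
  have hratio : w / (hh - w) ≤ C₀ / M := by
    have hden : hh / 2 ≤ hh - w := by linarith
    calc w / (hh - w) ≤ w / (hh / 2) := div_le_div_of_nonneg_left hwpos.le (by positivity) hden
      _ = C₀ / M := by rw [hw']; field_simp
  -- net centres and thresholds
  obtain ⟨c, hc⟩ : ∃ c : ℕ → ℂ, c = fun j : ℕ => x + (((ρ + R) / 2 : ℝ) : ℂ) *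
      Complex.exp (((-Real.pi + 2 * Real.pi * (j : ℝ) / M : ℝ) : ℂ) * Complex.I) := ⟨_, rfl⟩
  obtain ⟨kc, hkc⟩ := exists_coarse_cutoff x ρ R w hwpos
  refine ⟨max (∑ j ∈ Finset.range M, k (c j) w (hh - w)) kc, fun δ hδ hδρ _ _ => ?_⟩
  by_cases hfine : δ ≤ w
  · -- fine mesh: localize on the net, union bound
    have hsub : {γ : HexDomainSAW Ω δ (a δ) (b δ) |
        (⟨γ.walk.toCurve fun v => (δ : ℂ) * hexCenter v⟩ : Curve ℂ).HasTraversals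
          (max (∑ j ∈ Finset.range M, k (c j) w (hh - w)) kc) x ρ R} ⊆
        ⋃ j ∈ Finset.range M, {γ | (⟨γ.walk.toCurve fun v => (δ : ℂ) * hexCenter v⟩ : Curve ℂ).HasTraversals
          (k (c j) w (hh - w)) (c j) w (hh - w)} := by
      intro γ hγ
      obtain ⟨j, hj, hjT⟩ := Curve.exists_net_hasTraversals_of_hasTraversals hρ.le hρR hM1 (fun j => k (c j) w (hh - w))
        (Curve.HasTraversals.of_le hγ (le_max_left _ _))
      refine Set.mem_iUnion₂.2 ⟨j, Finset.mem_range.2 hj, ?_⟩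
      have e1 : (R - ρ) / 2 - w = hh - w := by rw [hhh]
      rw [← hw] at hjT
      rw [e1] at hjT
      simpa only [hc, Set.mem_setOf_eq] using hjT
    have hper : ∀ j ∈ Finset.range M,
        hexSAWLaw Ω δ (a δ) (b δ) {γ | (⟨γ.walk.toCurve fun v => (δ : ℂ) * hexCenter v⟩ : Curve ℂ).HasTraversals
          (k (c j) w (hh - w)) (c j) w (hh - w)} ≤ ENNReal.ofReal (K * (C₀ / M) ^ lam) := by
      intro j _
      refine (h δ hδ (c j) w (hh - w) hfine (by linarith) (by linarith)).trans
        (ENNReal.ofReal_le_ofReal (mul_le_mul_of_nonneg_left ?_ hK))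
      exact Real.rpow_le_rpow (div_nonneg hwpos.le (by linarith)) hratio (by linarith)
    calc hexSAWLaw Ω δ (a δ) (b δ) _
        ≤ hexSAWLaw Ω δ (a δ) (b δ) (⋃ j ∈ Finset.range M, {γ |
            (⟨γ.walk.toCurve fun v => (δ : ℂ) * hexCenter v⟩ : Curve ℂ).HasTraversals
              (k (c j) w (hh - w)) (c j) w (hh - w)}) := measure_mono hsub
      _ ≤ ∑ j ∈ Finset.range M, hexSAWLaw Ω δ (a δ) (b δ) {γ |
            (⟨γ.walk.toCurve fun v => (δ : ℂ) * hexCenter v⟩ : Curve ℂ).HasTraversals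
              (k (c j) w (hh - w)) (c j) w (hh - w)} := measure_biUnion_finset_le _ _
      _ ≤ ∑ j ∈ Finset.range M, ENNReal.ofReal (K * (C₀ / M) ^ lam) := Finset.sum_le_sum hper
      _ = ENNReal.ofReal ((M : ℝ) * (K * (C₀ / M) ^ lam)) := by
          rw [Finset.sum_const, Finset.card_range, nsmul_eq_mul, ← ENNReal.ofReal_natCast M,
            ← ENNReal.ofReal_mul (Nat.cast_nonneg M)]
      _ ≤ ENNReal.ofReal ((ρ / R) ^ lam') := ENNReal.ofReal_le_ofReal hsmall.le
      _ ≤ ENNReal.ofReal (4 ^ lam' * (ρ / R) ^ lam') :=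
          ENNReal.ofReal_le_ofReal (le_mul_of_one_le_left hε.le h4)
  · -- coarse mesh: the event is empty
    rw [not_le] at hfine
    have hempty : {γ : HexDomainSAW Ω δ (a δ) (b δ) |
        (⟨γ.walk.toCurve fun v => (δ : ℂ) * hexCenter v⟩ : Curve ℂ).HasTraversals
          (max (∑ j ∈ Finset.range M, k (c j) w (hh - w)) kc) x ρ R} = ∅ :=
      Set.eq_empty_of_forall_notMem fun γ hγ =>
        hkc Ω δ (a δ) (b δ) hfine.le hδρ (by linarith) γ (Curve.HasTraversals.of_le hγ (le_max_right _ _))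
    rw [hempty, measure_empty]
    exact bot_le

/-! ### Corollaries -/

/-- **`HexTight` from (H1) with any exponent `> 1`.** Aizenman–Burchard traversal bounds for the critical
hexagonal SAW law with SOME exponent `λ > 1` (per Dobrushin domain and endpoint approximation, threshold free
per shell, eventually in the mesh) already imply eventual tightness: bootstrap the exponent to `3 > 2`
(`traversalBound_of_exponent_gt_one`) and apply the landed rung `stub_hexTight_of_traversalBound`. -/
theorem hexTight_of_traversalBound_one
    (hTB : ∀ (D : DobrushinDomain) (a b : ℝ → HexVertex), IsEmbEndpointApprox hexGraph hexCenter D a b →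
      ∃ (k : ℂ → ℝ → ℝ → ℕ) (K lam δ₀ : ℝ), 0 ≤ K ∧ 1 < lam ∧ 0 < δ₀ ∧
        ∀ δ ∈ Set.Ioc (0 : ℝ) δ₀, ∀ (x : ℂ) (ρ R : ℝ), δ ≤ ρ → ρ < R → R ≤ 1 →
          hexSAWLaw D.carrier δ (a δ) (b δ)
            {γ | (⟨γ.walk.toCurve fun v => (δ : ℂ) * hexCenter v⟩ : Curve ℂ).HasTraversals
              (k x ρ R) x ρ R} ≤ ENNReal.ofReal (K * (ρ / R) ^ lam)) :
    Summit.CriticalPhenomena.SAWScalingLimit.Theses.SAWDevelopingMap.HexTight := by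
  refine HexConjecture.MarginalWedge.stub_hexTight_of_traversalBound fun D a b hab => ?_
  obtain ⟨k, K, lam, δ₀, hK, hlam, hδ₀, h⟩ := hTB D a b hab
  obtain ⟨k', hk'⟩ := traversalBound_of_exponent_gt_one _ a b k K lam δ₀ hK hlam h 3 (by norm_num)
  exact ⟨k', 4 ^ (3 : ℝ), 3, δ₀, by positivity, by norm_num, hδ₀, hk'⟩

/-- **Interior + boundary with exponents `> 1` give (H1) with exponent `3 > 2`.** The composition shape of the
line `reversal-virgin-disc`: an interior-shells bound (`closedBall x R ⊆ Ω`) and a boundary-shells bound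
(`closedBall x R ⊄ Ω`), EACH with its own exponent `> 1`, combine (thresholds `max`, constants `max`, exponent
`min`, mesh bound `min`) into a bound with exponent `min λ₁ λ₂ > 1` on all shells, which the bootstrap turns into
the `λ = 3` form of `HexTraversalBound` consumed by the rung. -/
theorem traversalBound_of_interior_one_of_boundary_one {Ω : Set ℂ} {a b : ℝ → HexVertex}
    (hI : ∃ (k : ℂ → ℝ → ℝ → ℕ) (K lam δ₀ : ℝ), 0 ≤ K ∧ 1 < lam ∧ 0 < δ₀ ∧
      ∀ δ ∈ Set.Ioc (0 : ℝ) δ₀, ∀ (x : ℂ) (ρ R : ℝ), δ ≤ ρ → ρ < R → R ≤ 1 →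
        Metric.closedBall x R ⊆ Ω →
        hexSAWLaw Ω δ (a δ) (b δ)
          {γ | (⟨γ.walk.toCurve fun v => (δ : ℂ) * hexCenter v⟩ : Curve ℂ).HasTraversals
            (k x ρ R) x ρ R} ≤ ENNReal.ofReal (K * (ρ / R) ^ lam))
    (hB : ∃ (k : ℂ → ℝ → ℝ → ℕ) (K lam δ₀ : ℝ), 0 ≤ K ∧ 1 < lam ∧ 0 < δ₀ ∧
      ∀ δ ∈ Set.Ioc (0 : ℝ) δ₀, ∀ (x : ℂ) (ρ R : ℝ), δ ≤ ρ → ρ < R → R ≤ 1 →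
        ¬ Metric.closedBall x R ⊆ Ω →
        hexSAWLaw Ω δ (a δ) (b δ)
          {γ | (⟨γ.walk.toCurve fun v => (δ : ℂ) * hexCenter v⟩ : Curve ℂ).HasTraversals
            (k x ρ R) x ρ R} ≤ ENNReal.ofReal (K * (ρ / R) ^ lam)) :
    ∃ (k : ℂ → ℝ → ℝ → ℕ) (K lam δ₀ : ℝ), 0 ≤ K ∧ 2 < lam ∧ 0 < δ₀ ∧
      ∀ δ ∈ Set.Ioc (0 : ℝ) δ₀, ∀ (x : ℂ) (ρ R : ℝ), δ ≤ ρ → ρ < R → R ≤ 1 →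
        hexSAWLaw Ω δ (a δ) (b δ)
          {γ | (⟨γ.walk.toCurve fun v => (δ : ℂ) * hexCenter v⟩ : Curve ℂ).HasTraversals
            (k x ρ R) x ρ R} ≤ ENNReal.ofReal (K * (ρ / R) ^ lam) := by
  obtain ⟨k₁, K₁, l₁, d₁, hK₁, hl₁, hd₁, h₁⟩ := hI
  obtain ⟨k₂, K₂, l₂, d₂, hK₂, hl₂, hd₂, h₂⟩ := hB
  -- all shells with exponent `min l₁ l₂ > 1`
  have hall : ∀ δ ∈ Set.Ioc (0 : ℝ) (min d₁ d₂), ∀ (x : ℂ) (ρ R : ℝ), δ ≤ ρ → ρ < R → R ≤ 1 →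
      hexSAWLaw Ω δ (a δ) (b δ)
        {γ | (⟨γ.walk.toCurve fun v => (δ : ℂ) * hexCenter v⟩ : Curve ℂ).HasTraversals
          (max (k₁ x ρ R) (k₂ x ρ R)) x ρ R} ≤ ENNReal.ofReal (max K₁ K₂ * (ρ / R) ^ min l₁ l₂) := by
    intro δ hδ x ρ R hδρ hρR hR1
    have hδ₁ : δ ∈ Set.Ioc 0 d₁ := ⟨hδ.1, hδ.2.trans (min_le_left _ _)⟩
    have hδ₂ : δ ∈ Set.Ioc 0 d₂ := ⟨hδ.1, hδ.2.trans (min_le_right _ _)⟩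
    have hρ : 0 < ρ := hδ.1.trans_le hδρ
    have hR : 0 < R := hρ.trans hρR
    have ht0 : 0 < ρ / R := div_pos hρ hR
    have ht1 : ρ / R ≤ 1 := (div_le_one hR).2 hρR.le
    have key : ∀ (k : ℕ) (K l : ℝ), 0 ≤ K → k ≤ max (k₁ x ρ R) (k₂ x ρ R) → K ≤ max K₁ K₂ →
        min l₁ l₂ ≤ l →
        hexSAWLaw Ω δ (a δ) (b δ)
          {γ | (⟨γ.walk.toCurve fun v => (δ : ℂ) * hexCenter v⟩ : Curve ℂ).HasTraversals k x ρ R} ≤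
          ENNReal.ofReal (K * (ρ / R) ^ l) →
        hexSAWLaw Ω δ (a δ) (b δ)
          {γ | (⟨γ.walk.toCurve fun v => (δ : ℂ) * hexCenter v⟩ : Curve ℂ).HasTraversals
            (max (k₁ x ρ R) (k₂ x ρ R)) x ρ R} ≤
          ENNReal.ofReal (max K₁ K₂ * (ρ / R) ^ min l₁ l₂) := by
      intro k K l hK0 hk hK hl hP
      refine le_trans (measure_mono fun γ hγ => ?_) (hP.trans (ENNReal.ofReal_le_ofReal ?_))
      · exact Curve.HasTraversals.of_le hγ hk
      · have hpow : (ρ / R) ^ l ≤ (ρ / R) ^ min l₁ l₂ :=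
          Real.rpow_le_rpow_of_exponent_ge ht0 ht1 hl
        calc K * (ρ / R) ^ l ≤ K * (ρ / R) ^ min l₁ l₂ := mul_le_mul_of_nonneg_left hpow hK0
          _ ≤ max K₁ K₂ * (ρ / R) ^ min l₁ l₂ :=
            mul_le_mul_of_nonneg_right hK (Real.rpow_nonneg ht0.le _)
    by_cases hin : Metric.closedBall x R ⊆ Ω
    · exact key _ _ _ hK₁ (le_max_left _ _) (le_max_left _ _) (min_le_left _ _)
        (h₁ δ hδ₁ x ρ R hδρ hρR hR1 hin)
    · exact key _ _ _ hK₂ (le_max_right _ _) (le_max_right _ _) (min_le_right _ _)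
        (h₂ δ hδ₂ x ρ R hδρ hρR hR1 hin)
  obtain ⟨k', hk'⟩ := traversalBound_of_exponent_gt_one Ω a b _ _ _ _ (hK₁.trans (le_max_left _ _))
    (lt_min hl₁ hl₂) hall 3 (by norm_num)
  exact ⟨k', 4 ^ (3 : ℝ), 3, min d₁ d₂, by positivity, by norm_num, lt_min hd₁ hd₂, hk'⟩

end Summit.CriticalPhenomena.SAWScalingLimit.Theorems.HexTight.ExponentBootstrap

end
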